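import Summits.AtomisticToContinuum.HydrodynamicLimit.Theorems.JParityClosureOddContactSymmetryKdeDefectPointwise
import Mathlib.MeasureTheory.Integral.Marginal
import HarnessLib

/-!
# Tools for the velocity-level Maxwell-defect bound K1 (line `KineticSlabSketch`, piece K1 of P4)

Crux `JParityClosure.OddContactSymmetry` (stmt-AtomisticToContinuum-17722, rev 5), line `KineticSlabSketch`, lead
`prover-line-stmt-AtomisticToContinuum-17722-c2-0` (cycle 3).  Continuity of the collision kinematics and of the Gaussian
kernel, the energy bounds `‖q‖² ≤ ‖v‖² + ‖w‖²` of the four collision velocities, the Gaussian growth bounds of the inverse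
reference law and of the deviation scale (`spike_div_le`, `devScale_le`), and the K1b step on the product space: integrating
out the coordinates of a finite set `rest` of the relative deviation of the leave-two-out KDE at a fixed query point
(`lmarginal_dev_le`, through `Function.updateFinset` / `MeasureTheory.lmarginal`).
-/

noncomputable section

open scoped BigOperators Classical InnerProductSpace ENNReal Topology
open Set MeasureTheory Filter Function
open Literature.Analysis.FluidPDE Literature.MathematicalPhysics.KineticTheory

namespace Summit.AtomisticToContinuum.HydrodynamicLimit.Theorems.OddContactSymmetryKineticSlab

/-! ## Step 2: continuity and elementary bounds -/

/-- `reflectVel ω` is continuous in the velocity pair. [folklore] -/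
theorem continuous_reflectVel_pair (ω : V3) : Continuous (fun q : V3 × V3 => reflectVel ω q) := by
  unfold reflectVel
  fun_prop

/-- The Gaussian kernel is jointly continuous in (centre, argument). [folklore] -/
theorem continuous_localMaxwellian₂ (s : ℝ) : Continuous (fun q : V3 × V3 => localMaxwellian 1 s q.1 q.2) := by
  unfold localMaxwellian
  fun_prop

/-- Energy bounds of the four collision velocities: `‖q‖² ≤ ‖v‖² + ‖w‖²` for `q` any of `v, w, v′, w′`. [folklore] -/
theorem norm_sq_four_le (ω v w : V3) :
    ‖(reflectVel ω (v, w)).1‖ ^ 2 ≤ ‖v‖ ^ 2 + ‖w‖ ^ 2 ∧ ‖(reflectVel ω (v, w)).2‖ ^ 2 ≤ ‖v‖ ^ 2 + ‖w‖ ^ 2 ∧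
      ‖v‖ ^ 2 ≤ ‖v‖ ^ 2 + ‖w‖ ^ 2 ∧ ‖w‖ ^ 2 ≤ ‖v‖ ^ 2 + ‖w‖ ^ 2 := by
  have hen := norm_sq_reflectVel_fst_add_norm_sq_reflectVel_snd ω (v, w)
  simp only at hen
  refine ⟨?_, ?_, ?_, ?_⟩ <;> nlinarith [sq_nonneg ‖(reflectVel ω (v, w)).1‖, sq_nonneg ‖(reflectVel ω (v, w)).2‖,
    sq_nonneg ‖v‖, sq_nonneg ‖w‖]

/-- Growth of the inverse reference law: `(P · M_T(q))⁻¹ · S = (S/P) · M_T(0)⁻¹ · exp(‖q‖²/(2T))` bounded through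
`‖q‖² ≤ E`. [folklore] -/
theorem spike_div_le {T P S E : ℝ} (hT : 0 < T) (hP : 0 < P) (hS : 0 ≤ S) {q : V3} (hq : ‖q‖ ^ 2 ≤ E) :
    S / (P * localMaxwellian 1 T (0 : V3) q) ≤ S / P * (localMaxwellian 1 T (0 : V3) 0)⁻¹ * Real.exp (E / (2 * T)) := by
  have hm0 : 0 < localMaxwellian 1 T (0 : V3) 0 := localMaxwellian_pos one_pos hT _ _
  rw [div_eq_mul_inv, mul_inv, inv_localMaxwellian_zero T q]
  have hexp : Real.exp (‖q‖ ^ 2 / (2 * T)) ≤ Real.exp (E / (2 * T)) :=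
    Real.exp_le_exp.2 (div_le_div_of_nonneg_right hq (by positivity))
  have h1 : 0 ≤ S * P⁻¹ * (localMaxwellian 1 T (0 : V3) 0)⁻¹ := by positivity
  calc S * (P⁻¹ * ((localMaxwellian 1 T (0 : V3) 0)⁻¹ * Real.exp (‖q‖ ^ 2 / (2 * T))))
      = S * P⁻¹ * (localMaxwellian 1 T (0 : V3) 0)⁻¹ * Real.exp (‖q‖ ^ 2 / (2 * T)) := by ring
    _ ≤ S * P⁻¹ * (localMaxwellian 1 T (0 : V3) 0)⁻¹ * Real.exp (E / (2 * T)) := mul_le_mul_of_nonneg_left hexp h1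
    _ = S / P * (localMaxwellian 1 T (0 : V3) 0)⁻¹ * Real.exp (E / (2 * T)) := by rw [div_eq_mul_inv S P]

/-- Growth of the deviation scale `√(C · M_{T'}(q)) / M_T(q) ≤ √(C M_{T'}(0)) · M_T(0)⁻¹ · exp(E/(2T))` for `‖q‖² ≤ E`.
[folklore] -/
theorem devScale_le {T T' C E : ℝ} (hT : 0 < T) (hT' : 0 < T') (hC : 0 ≤ C) {q : V3} (hq : ‖q‖ ^ 2 ≤ E) :
    Real.sqrt (C * localMaxwellian 1 T' (0 : V3) q) / localMaxwellian 1 T (0 : V3) q ≤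
      Real.sqrt (C * localMaxwellian 1 T' (0 : V3) 0) * (localMaxwellian 1 T (0 : V3) 0)⁻¹ * Real.exp (E / (2 * T)) := by
  have hm0 : 0 < localMaxwellian 1 T (0 : V3) 0 := localMaxwellian_pos one_pos hT _ _
  have hnum : Real.sqrt (C * localMaxwellian 1 T' (0 : V3) q) ≤ Real.sqrt (C * localMaxwellian 1 T' (0 : V3) 0) :=
    Real.sqrt_le_sqrt (mul_le_mul_of_nonneg_left (localMaxwellian_le_apply_zero hT' _ _) hC)
  rw [div_eq_mul_inv, inv_localMaxwellian_zero T q]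
  have hexp : Real.exp (‖q‖ ^ 2 / (2 * T)) ≤ Real.exp (E / (2 * T)) :=
    Real.exp_le_exp.2 (div_le_div_of_nonneg_right hq (by positivity))
  calc Real.sqrt (C * localMaxwellian 1 T' (0 : V3) q) * ((localMaxwellian 1 T (0 : V3) 0)⁻¹ * Real.exp (‖q‖ ^ 2 / (2 * T)))
      ≤ Real.sqrt (C * localMaxwellian 1 T' (0 : V3) 0) * ((localMaxwellian 1 T (0 : V3) 0)⁻¹ * Real.exp (E / (2 * T))) :=
        mul_le_mul hnum (mul_le_mul_of_nonneg_left hexp (by positivity)) (by positivity) (Real.sqrt_nonneg _)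
    _ = _ := by ring

/-! ## Step 3: the marginal (K1b) step on the product space -/

/-- **K1b on the product space**: integrating out the coordinates in `rest` of the relative deviation of the leave-two-out
KDE at a fixed query point `q` gives at most `√(pmax/P) · √(C M_{θ+ϑ²/2}(q)) / M_{θ+ϑ²}(q)`. [folklore] -/
theorem lmarginal_dev_le :
    ∀ (hB : ∀ {κ : Type} [Fintype κ] {θ ϑ : ℝ} (_hθ : 0 < θ) (_hϑ : 0 < ϑ) {p : κ → ℝ} {pmax : ℝ}
      (_hp0 : ∀ k, 0 ≤ p k) (_hpm : ∀ k, p k ≤ pmax) (_hP : 0 < ∑ k, p k) (q : V3),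
      ∫ v, |(∑ k, p k * localMaxwellian 1 (ϑ ^ 2) q (v k)) /
            ((∑ k, p k) * localMaxwellian 1 (θ + ϑ ^ 2) 0 q) - 1|
          ∂(Measure.pi fun _ : κ => gaussMeasure (0 : V3) θ) ≤
        Real.sqrt (pmax / ∑ k, p k) *
          (Real.sqrt ((4 * Real.pi * ϑ ^ 2) ^ (-(3 : ℝ) / 2) * localMaxwellian 1 (θ + ϑ ^ 2 / 2) 0 q) /
            localMaxwellian 1 (θ + ϑ ^ 2) 0 q))
    {θ ϑ : ℝ} (hθ : 0 < θ) (hϑ : 0 < ϑ) {n : ℕ} (rest : Finset (Fin n))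
    {p : Fin n → ℝ} {pmax : ℝ} (hp0 : ∀ k, 0 ≤ p k) (hpm : ∀ k, p k ≤ pmax) (hP : 0 < ∑ k ∈ rest, p k)
    (q : V3) (x : Fin n → V3),
    ∫⁻ y : (k : rest) → V3, ENNReal.ofReal
        |(∑ k ∈ rest, p k * localMaxwellian 1 (ϑ ^ 2) q (updateFinset x rest y k)) /
            ((∑ k ∈ rest, p k) * localMaxwellian 1 (θ + ϑ ^ 2) 0 q) - 1|
        ∂(Measure.pi fun _ : rest => gaussMeasure (0 : V3) θ) ≤
      ENNReal.ofReal (Real.sqrt (pmax / ∑ k ∈ rest, p k) *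
        (Real.sqrt ((4 * Real.pi * ϑ ^ 2) ^ (-(3 : ℝ) / 2) * localMaxwellian 1 (θ + ϑ ^ 2 / 2) 0 q) /
          localMaxwellian 1 (θ + ϑ ^ 2) 0 q)) := by
  intro hB θ ϑ hθ hϑ n rest p pmax hp0 hpm hP q x
  set P : ℝ := ∑ k ∈ rest, p k with hP_def
  set mq : ℝ := localMaxwellian 1 (θ + ϑ ^ 2) (0 : V3) q with hmq
  have hϑ2 : 0 < ϑ ^ 2 := by positivity
  have hmq0 : 0 < mq := localMaxwellian_pos one_pos (by positivity) _ _
  -- the integrand as a function of the `rest`-coordinates only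
  have hsum : ∀ y : (k : rest) → V3,
      ∑ k ∈ rest, p k * localMaxwellian 1 (ϑ ^ 2) q (updateFinset x rest y k) =
        ∑ k : rest, p k * localMaxwellian 1 (ϑ ^ 2) q (y k) := by
    intro y
    rw [← Finset.sum_coe_sort rest (fun k => p k * localMaxwellian 1 (ϑ ^ 2) q (updateFinset x rest y k))]
    refine Finset.sum_congr rfl fun k _ => ?_
    simp only [updateFinset, dif_pos k.2]
  have hPs : ∑ k : rest, p k = P := by rw [hP_def]; exact Finset.sum_coe_sort rest p
  simp_rw [hsum]
  -- K1b on the subtype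
  have hP' : 0 < ∑ k : rest, p (k : Fin n) := by rw [hPs]; exact hP
  have key := hB (κ := rest) hθ hϑ (p := fun k : rest => p k) (pmax := pmax) (fun k => hp0 k) (fun k => hpm k) hP' q
  rw [hPs] at key
  -- integrability of the (bounded, continuous) integrand
  set f : ((k : rest) → V3) → ℝ := fun y =>
    |(∑ k : rest, p k * localMaxwellian 1 (ϑ ^ 2) q (y k)) / (P * mq) - 1| with hf
  have hfc : Continuous f := by
    refine (Continuous.div_const ?_ _).sub continuous_const |>.abs
    refine continuous_finsetSum _ fun k _ => continuous_const.mul ?_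
    exact (continuous_localMaxwellian 1 (ϑ ^ 2) q).comp (continuous_apply k)
  have hfb : ∀ y, ‖f y‖ ≤ (∑ k : rest, p k * localMaxwellian 1 (ϑ ^ 2) (0 : V3) 0) / (P * mq) + 1 := by
    intro y
    rw [Real.norm_eq_abs, hf, abs_abs]
    have hnum0 : 0 ≤ ∑ k : rest, p k * localMaxwellian 1 (ϑ ^ 2) q (y k) :=
      Finset.sum_nonneg fun k _ => mul_nonneg (hp0 k) (localMaxwellian_nonneg zero_le_one hϑ2.le _ _)
    have hnum : ∑ k : rest, p k * localMaxwellian 1 (ϑ ^ 2) q (y k) ≤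
        ∑ k : rest, p k * localMaxwellian 1 (ϑ ^ 2) (0 : V3) 0 :=
      Finset.sum_le_sum fun k _ => mul_le_mul_of_nonneg_left (localMaxwellian_le_apply_zero hϑ2 _ _) (hp0 k)
    have hPm : 0 < P * mq := mul_pos hP hmq0
    rw [abs_le]
    constructor
    · have : 0 ≤ (∑ k : rest, p k * localMaxwellian 1 (ϑ ^ 2) q (y k)) / (P * mq) := div_nonneg hnum0 hPm.le
      have : 0 ≤ (∑ k : rest, p k * localMaxwellian 1 (ϑ ^ 2) (0 : V3) 0) / (P * mq) :=
        div_nonneg (hnum0.trans hnum) hPm.le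
      linarith
    · have := div_le_div_of_nonneg_right hnum hPm.le
      linarith
  have hfi : Integrable f (Measure.pi fun _ : rest => gaussMeasure (0 : V3) θ) :=
    (integrable_const _).mono' hfc.aestronglyMeasurable (Eventually.of_forall hfb)
  rw [← ofReal_integral_eq_lintegral_ofReal hfi (Eventually.of_forall fun y => abs_nonneg _)]
  exact ENNReal.ofReal_le_ofReal key

/-! ## Step 4: continuity of the deviation functionals -/

/-- The relative deviation of the leave-two-out KDE at a continuously moving query point is continuous in the
velocity configuration. [folklore] -/
theorem continuous_dev {θ ϑ : ℝ} (hθ : 0 < θ) (hϑ : 0 < ϑ) {n : ℕ} (rest : Finset (Fin n)) (p : Fin n → ℝ)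
    {P : ℝ} (hP : 0 < P) {Q : (Fin n → V3) → V3} (hQ : Continuous Q) :
    Continuous fun v : Fin n → V3 =>
      (∑ k ∈ rest, p k * localMaxwellian 1 (ϑ ^ 2) (Q v) (v k)) / (P * localMaxwellian 1 (θ + ϑ ^ 2) 0 (Q v)) - 1 := by
  refine Continuous.sub ?_ continuous_const
  refine Continuous.div ?_ ?_ ?_
  · refine continuous_finsetSum _ fun k _ => continuous_const.mul ?_
    have hk : Continuous fun v : Fin n → V3 => v k := continuous_apply k
    show Continuous fun v : Fin n → V3 => localMaxwellian 1 (ϑ ^ 2) (Q v) (v k)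
    unfold localMaxwellian
    fun_prop
  · refine continuous_const.mul ?_
    show Continuous fun v : Fin n → V3 => localMaxwellian 1 (θ + ϑ ^ 2) 0 (Q v)
    unfold localMaxwellian
    fun_prop
  · intro v
    exact (mul_pos hP (localMaxwellian_pos one_pos (by positivity) _ _)).ne'

/-- The flux factor `max ⟪ω, v_i − v_j⟫ 0` is continuous. [folklore] -/
theorem continuous_fluxFactor {n : ℕ} (ω : V3) (i j : Fin n) :
    Continuous fun v : Fin n → V3 => max ⟪ω, v i - v j⟫_ℝ 0 := by
  fun_prop

end Summit.AtomisticToContinuum.HydrodynamicLimit.Theorems.OddContactSymmetryKineticSlab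

end
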